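import Literature.MathematicalPhysics.QuantumFieldTheory.Balaban1983to89.B7Prop1Explicit
import HarnessLib

/-!
# NE7AxialGaugeLattice — lattice bookkeeping for the strata induction of F3 `NE7AxialGaugeDerivatives` (row NE7, gen 111): `l1` on the non-negative cone,
# coordinates of translates `x + t·e_j`, the foot `x* = x − (x_j − y_j)·e_j` of the segment through `x` in direction `j` and the points of that segment

Cell `pub-balaban`, rung (B)+1 sub-cell t4, lineage `b2b-balaban-t4-ne7-p1` (CRUX PROVER NE7 #1 = OWNER of BINDER row NE7), generation 111.  Memo
`t4/b2b-balaban-t4-ne7-p1-g111/ROAD-G111.md`; split off F3 for the 400-line cap.  Line «(9)-TYPE k-UNIFORM HÖLDER REGULARITY OF EVERY CONSTRAINED SMALL-FIELD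
MINIMISER, every β < 1» (ROAD-G110 §NEXT (N2)).
WHAT ([folklore]; 0 def, 0 sorry; any `d`).  `l1_sub_mono`, `toNat_coord_le_l1`, `add_e_apply_of_ne`, `add_zsmul_e_apply_of_ne`, `add_zsmul_e_apply_self`,
`add_natCast_succ_zsmul`, `l1_add_e_le`, `sub_add_zsmul_apply_self`, `sub_add_zsmul_apply_of_ne`, `sub_zsmul_apply_self`, `sub_zsmul_apply_of_ne`, **`foot_spec`**, **`seg_point_spec`**.
HONEST FRAMING (page 1): `ℤ^d` arithmetic; nothing of Bałaban's asserted; NOT NE3∕NE7 as spine nodes; spine 0∕9; finite T⁴ rung (B)+1 — NOT infinite volume, NOT mass gap, NOT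
BetaPertH, NOT Clay.
-/

set_option autoImplicit false

namespace Summit.QuantumFields.BalabanUV.T4Continuum.NE7AxialGaugeLattice

open Literature.MathematicalPhysics.QuantumFieldTheory.Balaban1983to89
open B7Prop1Explicit

/-! ## §1 Lattice bookkeeping -/

section Lattice

variable {d : ℕ}

/-- `l1(· − y)` is monotone on the order interval above `y`: `y ≤ z ≤ x ⟹ l1(z − y) ≤ l1(x − y)` (cf. the tree's `NE3QbarIterCovLift.l1_le_of_nonneg_le`,
not imported here to keep the closure small). [folklore] -/
theorem l1_sub_mono {y z x : Site d} (hyz : y ≤ z) (hzx : z ≤ x) : l1 (z - y) ≤ l1 (x - y) := by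
  unfold l1
  refine Finset.sum_le_sum fun κ _ => ?_
  have h0 : y κ ≤ z κ := hyz κ
  have h1 : z κ ≤ x κ := hzx κ
  simp only [Pi.sub_apply]
  omega

/-- One non-negative coordinate is at most the `l1` norm. [folklore] -/
theorem toNat_coord_le_l1 {u : Site d} (hu : 0 ≤ u) (j : Fin d) : (u j).toNat ≤ l1 u := by
  unfold l1
  have h0 : 0 ≤ u j := hu j
  have h : (u j).toNat = (u j).natAbs := by omega
  rw [h]
  exact Finset.single_le_sum (f := fun κ => (u κ).natAbs) (fun _ _ => Nat.zero_le _) (Finset.mem_univ j)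

/-- Translating by `e_λ` keeps the other coordinates. [folklore] -/
theorem add_e_apply_of_ne (x : Site d) {lam κ : Fin d} (h : κ ≠ lam) : (x + e lam) κ = x κ := by
  rw [Pi.add_apply, e_apply, if_neg h, add_zero]

/-- Translating by `t·e_j` keeps the other coordinates. [folklore] -/
theorem add_zsmul_e_apply_of_ne (x : Site d) {j κ : Fin d} (h : κ ≠ j) (t : ℤ) : (x + t • e j) κ = x κ := by
  simp [e_apply, h]

/-- Translating by `t·e_j` moves the `j`-th coordinate by `t`. [folklore] -/
theorem add_zsmul_e_apply_self (x : Site d) (j : Fin d) (t : ℤ) : (x + t • e j) j = x j + t := by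
  simp [e_apply]

/-- `x + (t+1)·e_j = (x + t·e_j) + e_j`. [folklore] -/
theorem add_natCast_succ_zsmul (x : Site d) (j : Fin d) (t : ℕ) :
    x + (((t + 1 : ℕ) : ℤ)) • e j = x + ((t : ℕ) : ℤ) • e j + e j := by
  rw [Nat.cast_succ, add_smul, one_smul, add_assoc]

/-- `l1(v + e_μ) ≤ l1(v) + 1`. [folklore] -/
theorem l1_add_e_le (v : Site d) (μ : Fin d) : l1 (v + e μ) ≤ l1 v + 1 := by
  have h := l1_add_le v (e μ)
  have h1 : l1 (e μ : Site d) = 1 := by simpa using l1_vec ((μ, true) : Letter d)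
  omega

/-- Coordinates of `x − M·e_j + t·e_j`. [folklore] -/
theorem sub_add_zsmul_apply_self (x : Site d) (j : Fin d) (M t : ℤ) : (x - M • e j + t • e j) j = x j - M + t := by
  simp [e_apply]

/-- Coordinates of `x − M·e_j + t·e_j` off the direction `j`. [folklore] -/
theorem sub_add_zsmul_apply_of_ne (x : Site d) {j κ : Fin d} (h : κ ≠ j) (M t : ℤ) : (x - M • e j + t • e j) κ = x κ := by
  simp [e_apply, h]

/-- Coordinates of `x − M·e_j`. [folklore] -/
theorem sub_zsmul_apply_self (x : Site d) (j : Fin d) (M : ℤ) : (x - M • e j) j = x j - M := by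
  simp [e_apply]

/-- Coordinates of `x − M·e_j` off the direction `j`. [folklore] -/
theorem sub_zsmul_apply_of_ne (x : Site d) {j κ : Fin d} (h : κ ≠ j) (M : ℤ) : (x - M • e j) κ = x κ := by
  simp [e_apply, h]

/-- **The foot of the segment**: for `y ≤ x` and a direction `j`, the point `x* = x − (x_j − y_j)·e_j` satisfies `y ≤ x* ≤ x`, `x*_j = y_j`, `x*_κ = x_κ`
(`κ ≠ j`). [folklore] -/
theorem foot_spec {y x : Site d} (hyx : y ≤ x) (j : Fin d) :
    y ≤ x - (((x j - y j).toNat : ℕ) : ℤ) • e j ∧ x - (((x j - y j).toNat : ℕ) : ℤ) • e j ≤ x ∧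
      (x - (((x j - y j).toNat : ℕ) : ℤ) • e j) j = y j ∧ (∀ κ : Fin d, κ ≠ j → (x - (((x j - y j).toNat : ℕ) : ℤ) • e j) κ = x κ) ∧
      x - (((x j - y j).toNat : ℕ) : ℤ) • e j + (((x j - y j).toNat : ℕ) : ℤ) • e j = x := by
  have hyxj : y j ≤ x j := hyx j
  have hm : ((((x j - y j).toNat : ℕ) : ℤ)) = x j - y j := Int.toNat_of_nonneg (by omega)
  have hj : (x - (((x j - y j).toNat : ℕ) : ℤ) • e j) j = y j := by
    rw [sub_zsmul_apply_self]; omega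
  have hne : ∀ κ : Fin d, κ ≠ j → (x - (((x j - y j).toNat : ℕ) : ℤ) • e j) κ = x κ := fun κ hκ =>
    sub_zsmul_apply_of_ne x hκ _
  refine ⟨fun κ => ?_, fun κ => ?_, hj, hne, sub_add_cancel _ _⟩
  · by_cases hκ : κ = j
    · rw [hκ, hj]
    · rw [hne κ hκ]; exact hyx κ
  · by_cases hκ : κ = j
    · rw [hκ, hj]; exact hyxj
    · rw [hne κ hκ]

/-- **The points of the segment** `z_t = x* + t·e_j`, `t ≤ x_j − y_j`, lie between `y` and `x`. [folklore] -/
theorem seg_point_spec {y x : Site d} (hyx : y ≤ x) (j : Fin d) {t : ℕ} (ht : t ≤ (x j - y j).toNat) :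
    y ≤ x - (((x j - y j).toNat : ℕ) : ℤ) • e j + ((t : ℕ) : ℤ) • e j ∧
      x - (((x j - y j).toNat : ℕ) : ℤ) • e j + ((t : ℕ) : ℤ) • e j ≤ x := by
  have hyxj : y j ≤ x j := hyx j
  have hm : ((((x j - y j).toNat : ℕ) : ℤ)) = x j - y j := Int.toNat_of_nonneg (by omega)
  have htz : ((t : ℕ) : ℤ) ≤ (((x j - y j).toNat : ℕ) : ℤ) := by exact_mod_cast ht
  have hself : (x - (((x j - y j).toNat : ℕ) : ℤ) • e j + ((t : ℕ) : ℤ) • e j) j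
      = x j - (((x j - y j).toNat : ℕ) : ℤ) + ((t : ℕ) : ℤ) := sub_add_zsmul_apply_self x j _ _
  have h1 : ∀ κ : Fin d, y κ ≤ (x - (((x j - y j).toNat : ℕ) : ℤ) • e j + ((t : ℕ) : ℤ) • e j) κ := by
    intro κ
    by_cases hκ : κ = j
    · rw [hκ, hself]; omega
    · rw [sub_add_zsmul_apply_of_ne x hκ]; exact hyx κ
  have h2 : ∀ κ : Fin d, (x - (((x j - y j).toNat : ℕ) : ℤ) • e j + ((t : ℕ) : ℤ) • e j) κ ≤ x κ := by
    intro κ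
    by_cases hκ : κ = j
    · rw [hκ, hself]; omega
    · rw [sub_add_zsmul_apply_of_ne x hκ]
  exact ⟨h1, h2⟩

end Lattice

end Summit.QuantumFields.BalabanUV.T4Continuum.NE7AxialGaugeLattice
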